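import Summits.Ventures.PercRepro.MSTightOneVertexDelta

/-!
# The one-outside-vertex case (Theorem B of Addendum 38 §4), part IV: the injection (e1), the
# count, and THEOREM B

Dossier proofs/MINE1-theoremS.md, Addendum 38 §4 (d)–(e) in the simplified form of Addendum 40
(iii)–(v). For a one-vertex residue instance (MSTightOneVertexSetup.lean) with
`P₁ = T₁ ∖ T₀`, `𝒫' = {t ∈ P₁ : I ⊄ t}` and `𝒫'' = {t ∈ P₁ : I ⊆ t}`:
* (e1) for `t ∈ 𝒫'` and `∅ ≠ g ∈ Λ`, `u ∖ (t ∪ g) = (u ∖ g) ∖ (t ∪ m)` is a difference of `P`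
  meeting `I`, hence outside `Λ ⊆ 2^W` (`sdiff_union_mem`); the family
  `𝒮 = {t ∪ g : t ∈ 𝒫', ∅ ≠ g ∈ Λ}` (`famS`) therefore injects into `D(P) ∖ Λ` by `s ↦ u ∖ s`;
* `phi t = t` when `t` meets `W`, `phi t = t ∪ N` otherwise (`N = u ∖ R ∈ Λ` is nonempty) maps
  `𝒫'` injectively into `𝒮` (`phi_mem`, `phi_injOn`);
* some `t ∈ 𝒫'` is disjoint from `I` (`I ∈ D(P)` is `y ∖ y'` with `y'` a member through `m`);
  a maximal such `t*` and `a ∈ W ∖ t*` give `t* ∪ {a} ∈ 𝒮 ∖ phi(𝒫')`, so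
  `|𝒮| ≥ |𝒫'| + 1` (`card_Pprime_add_one_le_card_famS`);
* with (e2) (MSTightOneVertexDelta.lean) the two injections have disjoint images in `D(P) ∖ Λ`
  (the first meets `I`, the second avoids it), so `|D(P) ∖ Λ| ≥ |𝒫'| + 1 + |𝒫''| = |P₁| + 1`,
  against `|D(P) ∖ Λ| = |P₁|` (MSTightOneVertexAnatomy.lean).
**Theorem B** (`OneVertexData.false`): a one-vertex residue instance without a witness does not
exist.
-/

namespace PercRepro.MSTight

open Finset
open scoped FinsetFamily

variable {α : Type*} [DecidableEq α] [Fintype α]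

namespace OneVertexData

variable {u : Finset α} {L' T : Finset (Finset α)} {m : α}

/-- `𝒫'`: the partnerless members through `m` (with `m` removed) not containing `I`. -/
def Pprime (u : Finset α) (L' T : Finset (Finset α)) (m : α) : Finset (Finset α) :=
  (partr m T \ part0 m T).filter fun t => ¬ I u L' m ⊆ t

/-- Membership in `𝒫'`. -/
theorem mem_Pprime {t : Finset α} :
    t ∈ Pprime u L' T m ↔ t ∈ partr m T ∧ t ∉ part0 m T ∧ ¬ I u L' m ⊆ t := by
  simp only [Pprime, mem_filter, mem_sdiff]
  tauto

/-- The family `𝒮 = {t ∪ g : t ∈ 𝒫', ∅ ≠ g ∈ Λ}`. -/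
def famS (u : Finset α) (L' T : Finset (Finset α)) (m : α) : Finset (Finset α) :=
  univ.filter fun s => ∃ t ∈ Pprime u L' T m,
    ∃ g ∈ link (upSet (insert m u) L') u, g ≠ ∅ ∧ s = t ∪ g

/-- Membership in `𝒮`. -/
theorem mem_famS {s : Finset α} :
    s ∈ famS u L' T m ↔ ∃ t ∈ Pprime u L' T m,
      ∃ g ∈ link (upSet (insert m u) L') u, g ≠ ∅ ∧ s = t ∪ g := by
  simp [famS]

/-- The map `phi` of (e1): `t ∪ N` when `t` is disjoint from `W`, else `t` itself. -/
def phi (u : Finset α) (L' T : Finset (Finset α)) (m : α) (t : Finset α) : Finset α :=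
  if Disjoint t (W u L' m) then t ∪ (u \ Rstar (partner m T)) else t

/-- `u ∖ g ∈ T₀` for every nonempty `g ∈ Λ`. -/
theorem sdiff_mem_part0_of_mem_link (d : OneVertexData u L' T m) {g : Finset α}
    (hg : g ∈ link (upSet (insert m u) L') u) (hg0 : g ≠ ∅) : u \ g ∈ part0 m T := by
  obtain ⟨hgu, hgU⟩ := mem_link.1 hg
  refine d.mem_part0_iff.2 ⟨sdiff_subset, ?_, hgU⟩
  intro h
  obtain ⟨a, ha⟩ := nonempty_iff_ne_empty.2 hg0
  have : a ∈ u \ g := by rw [h]; exact hgu ha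
  exact (mem_sdiff.1 this).2 ha

/-- **(e1), membership.** For `t ∈ 𝒫'` and `∅ ≠ g ∈ Λ`, `u ∖ (t ∪ g) ∈ D(P) ∖ Λ` and it
meets `I`. -/
theorem sdiff_union_mem (d : OneVertexData u L' T m) {t g : Finset α} (ht : t ∈ Pprime u L' T m)
    (hg : g ∈ link (upSet (insert m u) L') u) (hg0 : g ≠ ∅) :
    u \ (t ∪ g) ∈ diffsX m T \ link (upSet (insert m u) L') u ∧
      ¬ Disjoint (I u L' m) (u \ (t ∪ g)) := by
  obtain ⟨htP, -, hIt⟩ := mem_Pprime.1 ht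
  have h1 := sdiff_mem_diffsX_of_mem_part0_of_mem_partr (d.sdiff_mem_part0_of_mem_link hg hg0) htP
  have heq : (u \ g) \ t = u \ (t ∪ g) := by
    ext a; simp only [mem_sdiff, mem_union, not_or]; tauto
  rw [heq] at h1
  obtain ⟨a, haI, hat⟩ := not_subset.1 hIt
  have hag : a ∉ g := disjoint_left.1 (d.disjoint_I_of_mem_link hg) haI
  have hamem : a ∈ u \ (t ∪ g) := mem_sdiff.2 ⟨I_subset haI, fun h => (mem_union.1 h).elim hat hag⟩
  refine ⟨mem_sdiff.2 ⟨h1, ?_⟩, ?_⟩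
  · intro hΛ
    have := d.subset_W_of_mem_link hΛ hamem
    exact disjoint_left.1 disjoint_I_W haI this
  · rw [not_disjoint_iff]
    exact ⟨a, haI, hamem⟩

/-- `N = u ∖ R ∈ Λ`. -/
theorem sdiff_Rstar_mem_link (d : OneVertexData u L' T m) :
    u \ Rstar (partner m T) ∈ link (upSet (insert m u) L') u := by
  rw [d.mem_link_iff']
  refine ⟨sdiff_subset, ?_⟩
  rw [sdiff_inter_self]
  exact d.empty_mem_diffsY

/-- `N ⊆ W`. -/
theorem sdiff_Rstar_subset_W (d : OneVertexData u L' T m) :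
    u \ Rstar (partner m T) ⊆ W u L' m := by
  intro a ha
  obtain ⟨hau, haR⟩ := mem_sdiff.1 ha
  have : a ∈ I u L' m ∪ W u L' m := by rw [I_union_W]; exact hau
  rcases mem_union.1 this with h | h
  · exact absurd (d.I_subset_Rstar h) haR
  · exact h

/-- `phi` maps `𝒫'` into `𝒮`. -/
theorem phi_mem (d : OneVertexData u L' T m) {t : Finset α} (ht : t ∈ Pprime u L' T m) :
    phi u L' T m t ∈ famS u L' T m := by
  unfold phi
  split_ifs with hd
  · exact mem_famS.2 ⟨t, ht, _, d.sdiff_Rstar_mem_link,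
      nonempty_iff_ne_empty.1 d.sdiff_Rstar_nonempty, rfl⟩
  · obtain ⟨a, hat, haW⟩ := not_disjoint_iff.1 hd
    refine mem_famS.2 ⟨t, ht, {a}, singleton_mem_link_of_mem_W haW, singleton_ne_empty a, ?_⟩
    rw [union_eq_left.2 (singleton_subset_iff.2 hat)]

/-- `phi` is injective on `𝒫'`. -/
theorem phi_injOn (d : OneVertexData u L' T m) :
    Set.InjOn (phi u L' T m) ↑(Pprime u L' T m) := by
  intro t ht t' ht' h
  have htP := (mem_Pprime.1 (mem_coe.1 ht)).1
  have ht'P := (mem_Pprime.1 (mem_coe.1 ht')).1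
  have hNW := d.sdiff_Rstar_subset_W
  unfold phi at h
  split_ifs at h with hd hd' hd'
  · have h1 : Disjoint t (u \ Rstar (partner m T)) := disjoint_of_subset_right hNW hd
    have h2 : Disjoint t' (u \ Rstar (partner m T)) := disjoint_of_subset_right hNW hd'
    rw [← union_sdiff_cancel_right h1, ← union_sdiff_cancel_right h2, h]
  · exfalso
    exact d.not_sdiff_subset_of_mem_partr ht'P (h ▸ subset_union_right)
  · exfalso
    exact d.not_sdiff_subset_of_mem_partr htP (h.symm ▸ subset_union_right)
  · exact h

/-- Some member of `𝒫'` is disjoint from `I` (`I ∈ D(P)` is `y ∖ y'` with `m ∈ y'`). -/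
theorem exists_mem_Pprime_disjoint (d : OneVertexData u L' T m) :
    ∃ t ∈ Pprime u L' T m, Disjoint (I u L' m) t := by
  obtain ⟨hI, -⟩ := mem_diffsX_iff.1 d.I_mem_diffsX
  obtain ⟨y, hy, y', hy', hyy'⟩ := mem_diffs.1 hI
  have hdisj : Disjoint (I u L' m) y' := by rw [← hyy']; exact disjoint_sdiff_self_left
  have hIne := d.I_nonempty
  have hmy' : m ∈ y' := by
    by_contra hm
    have hsub := d.I_subset_of_mem_part0 (mem_part0.2 ⟨hy', hm⟩)
    obtain ⟨a, ha⟩ := hIne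
    exact disjoint_left.1 hdisj ha (hsub ha)
  have ht : y'.erase m ∈ partr m T := mem_partr.2 ⟨notMem_erase m y', by rw [insert_erase hmy']; exact hy'⟩
  have hdisj' : Disjoint (I u L' m) (y'.erase m) := disjoint_of_subset_right (erase_subset m y') hdisj
  refine ⟨y'.erase m, mem_Pprime.2 ⟨ht, ?_, ?_⟩, hdisj'⟩
  · intro h0
    have hsub := d.I_subset_of_mem_part0 h0
    obtain ⟨a, ha⟩ := hIne
    exact disjoint_left.1 hdisj' ha (hsub ha)
  · intro hsub
    obtain ⟨a, ha⟩ := hIne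
    exact disjoint_left.1 hdisj' ha (hsub ha)

/-- A member of `𝒫'` disjoint from `I` lies inside `W`. -/
theorem subset_W_of_disjoint (d : OneVertexData u L' T m) {t : Finset α} (ht : t ∈ partr m T)
    (hdisj : Disjoint (I u L' m) t) : t ⊆ W u L' m := by
  intro a hat
  have : a ∈ I u L' m ∪ W u L' m := by rw [I_union_W]; exact d.subset_of_mem_partr ht hat
  rcases mem_union.1 this with h | h
  · exact absurd hat (disjoint_left.1 hdisj h)
  · exact h

/-- **`|𝒮| ≥ |𝒫'| + 1`.** -/
theorem card_Pprime_add_one_le_card_famS (d : OneVertexData u L' T m) :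
    (Pprime u L' T m).card + 1 ≤ (famS u L' T m).card := by
  set A := (Pprime u L' T m).filter fun t => Disjoint (I u L' m) t with hA
  have hAne : A.Nonempty := by
    obtain ⟨t, ht, hd⟩ := d.exists_mem_Pprime_disjoint
    exact ⟨t, mem_filter.2 ⟨ht, hd⟩⟩
  obtain ⟨ts, hts, hmax⟩ := exists_max_image A card hAne
  obtain ⟨htsP, htsd⟩ := mem_filter.1 hts
  have htsT := (mem_Pprime.1 htsP).1
  have htsW : ts ⊆ W u L' m := d.subset_W_of_disjoint htsT htsd
  have htsne : ts ≠ W u L' m := by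
    intro h
    exact d.not_W_subset (mem_partr.1 htsT).2 (h ▸ subset_insert m ts)
  obtain ⟨a, haW, hats⟩ := exists_of_ssubset (ssubset_of_subset_of_ne htsW htsne)
  -- `s₀ = ts ∪ {a}` lies in `𝒮` but not in `phi(𝒫')`
  have hs₀ : ts ∪ {a} ∈ famS u L' T m :=
    mem_famS.2 ⟨ts, htsP, {a}, singleton_mem_link_of_mem_W haW, singleton_ne_empty a, rfl⟩
  have hs₀' : ts ∪ {a} ∉ (Pprime u L' T m).image (phi u L' T m) := by
    intro h
    obtain ⟨t', ht'P, h⟩ := mem_image.1 h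
    have ht'T := (mem_Pprime.1 ht'P).1
    unfold phi at h
    split_ifs at h with hd
    · -- `t' ∪ N ⊆ W` and `t'` is disjoint from `W`: `t' = ∅`
      have ht'W : t' ⊆ W u L' m := by
        intro b hb
        have : b ∈ ts ∪ {a} := by rw [← h]; exact mem_union_left _ hb
        rcases mem_union.1 this with hb' | hb'
        · exact htsW hb'
        · rw [mem_singleton.1 hb']; exact haW
      have ht'e : t' = ∅ := by
        rw [eq_empty_iff_forall_notMem]
        intro b hb
        exact disjoint_left.1 hd hb (ht'W hb)
      rw [ht'e] at ht'T
      exact d.empty_notMem_partr ht'T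
    · -- `t' = ts ∪ {a}` is a larger member of `A`
      have ht'A : t' ∈ A := by
        refine mem_filter.2 ⟨ht'P, ?_⟩
        rw [h, disjoint_union_right]
        refine ⟨htsd, disjoint_singleton_right.2 fun haI => ?_⟩
        exact disjoint_left.1 disjoint_I_W haI haW
      have hcard := hmax t' ht'A
      rw [h, card_union_of_disjoint (disjoint_singleton_right.2 hats), card_singleton] at hcard
      omega
  have hsub : insert (ts ∪ {a}) ((Pprime u L' T m).image (phi u L' T m)) ⊆ famS u L' T m := by
    intro s hs
    rcases mem_insert.1 hs with rfl | hs
    · exact hs₀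
    · obtain ⟨t, ht, rfl⟩ := mem_image.1 hs
      exact d.phi_mem ht
  have h1 := card_le_card hsub
  rw [card_insert_of_notMem hs₀', card_image_of_injOn d.phi_injOn] at h1
  exact h1

/-- **THEOREM B.** A one-vertex residue instance without a witness does not exist. -/
theorem false (d : OneVertexData u L' T m) : False := by
  set Λ := link (upSet (insert m u) L') u with hΛ
  set Dl := diffsX m T \ Λ with hDl
  set P2 := (partr m T \ part0 m T).filter fun t => I u L' m ⊆ t with hP2
  -- `|D(P) ∖ Λ| = |P₁| = |𝒫'| + |𝒫''|`
  have h1 : Dl.card = (partr m T \ part0 m T).card := d.card_diffsX_sdiff_link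
  have h2 : P2.card + (Pprime u L' T m).card = (partr m T \ part0 m T).card :=
    card_filter_add_card_filter_not _
  -- the two images
  set Im1 := (famS u L' T m).image fun s => u \ s with hIm1
  set Im2 := P2.image (delta u T m) with hIm2
  have hIm1sub : Im1 ⊆ Dl := by
    intro x hx
    obtain ⟨s, hs, rfl⟩ := mem_image.1 hx
    obtain ⟨t, ht, g, hg, hg0, rfl⟩ := mem_famS.1 hs
    exact (d.sdiff_union_mem ht hg hg0).1
  have hIm2sub : Im2 ⊆ Dl := by
    intro x hx
    obtain ⟨t, ht, rfl⟩ := mem_image.1 hx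
    obtain ⟨ht', -⟩ := mem_filter.1 ht
    exact d.delta_mem (mem_sdiff.1 ht').1 (mem_sdiff.1 ht').2
  have hdisj : Disjoint Im1 Im2 := by
    rw [disjoint_left]
    intro x hx1 hx2
    obtain ⟨s, hs, rfl⟩ := mem_image.1 hx1
    obtain ⟨t, ht, g, hg, hg0, rfl⟩ := mem_famS.1 hs
    obtain ⟨t', ht', heq⟩ := mem_image.1 hx2
    have hd := disjoint_delta_I (T := T) (mem_filter.1 ht').2
    rw [heq] at hd
    exact (d.sdiff_union_mem ht hg hg0).2 hd
  have hc1 : Im1.card = (famS u L' T m).card := by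
    refine card_image_of_injOn ?_
    intro s hs s' hs' h
    have hsu : s ⊆ u := by
      obtain ⟨t, ht, g, hg, -, rfl⟩ := mem_famS.1 (mem_coe.1 hs)
      exact union_subset (d.subset_of_mem_partr (mem_Pprime.1 ht).1) (mem_link.1 hg).1
    have hs'u : s' ⊆ u := by
      obtain ⟨t, ht, g, hg, -, rfl⟩ := mem_famS.1 (mem_coe.1 hs')
      exact union_subset (d.subset_of_mem_partr (mem_Pprime.1 ht).1) (mem_link.1 hg).1
    exact eq_of_sdiff_eq_of_subset hsu hs'u h
  have hc2 : Im2.card = P2.card := card_image_of_injOn d.delta_injOn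
  have h3 : (Im1 ∪ Im2).card ≤ Dl.card := card_le_card (union_subset hIm1sub hIm2sub)
  rw [card_union_of_disjoint hdisj, hc1, hc2] at h3
  have h4 := d.card_Pprime_add_one_le_card_famS
  omega

end OneVertexData

end PercRepro.MSTight
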